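import Summits.SmoothPoincare4.SmoothPoincare4.Theorems.SblfDescentRungOneHelperTimelikeDichotomy
import Summits.SmoothPoincare4.SmoothPoincare4.Theorems.SblfDescentRungOneHelperTimelikeReversedLoop
import Summits.SmoothPoincare4.SmoothPoincare4.Theorems.SblfDescentRungOneHelperTimelikeLoopReversal
import Literature.Topology.FourManifolds.SimplifiedBrokenLefschetzSides
import Literature.AlgebraicTopology.SingularHomology.LocallyFlatComplement
import Mathlib.Analysis.Convex.Contractible
import HarnessLib

/-!
# The untwistedness of the round handle, reduced to the essentiality of the vanishing cycle

Helper layer `helper_timelike_of_essential` of stub `helper_foldNF_timelike` (the untwistedness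
of the round `1`-handle), line `Sketch`, crux `SblfDescent.RungOne`.

(Crux item stmt-SmoothPoincare4-18531; skeleton `Cruxes/RungOne/Lines/Sketch.lean`.)

Let `f : X → S²` be a genus-one Lefschetz-free SBLF with equatorial round image, `v` the
torus-side pole, `e` the round circle by longitude, `ν₀` a tube about it and
`g (t, x) = ⟪v, f (ν₀ (circlePt t, x))⟫` the height family with page Hessians `H_t`.  We prove
the conclusion of `helper_foldNF_timelike` — a continuous `1`-periodic field of `H_t`-timelike
vectors — ASSUMING the **essentiality of the vanishing cycle**: for `H_0`-orthogonal
`H_0`-spacelike `b₁, b₂`, the small circles `θ ↦ ν₀ (circlePt 0, r (cos 2πθ b₁ + sin 2πθ b₂))`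
have, for all small `r > 0`, non-zero Hurewicz class in `H₁` of the torus side
`f⁻¹{⟪y, v⟫ > 0}` (Baykur–Kamada 2015, §2: the higher-side fibre is the lower-side fibre with a
`1`-handle attached along the vanishing pair, so the vanishing cycle is non-separating).
Proof (`helper_timelike_of_essential`): by the nappe dichotomy (`helper_timelike_dichotomy`)
it suffices to exclude a continuous antiperiodic timelike field; such a field joins the
vanishing cycle to its reverse through closed curves on the torus side
(`helper_timelike_reversedLoop`), so its Hurewicz class `x` has `2x = 0`
(`helper_timelike_loopReversal`); but `H₁(torus side; ℤ) ≅ H₁(T²; ℤ) ≅ ℤ²` is torsion-free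
(the side is `F × ℝ²`, `SimplifiedBrokenLefschetzSides`), so `x = 0`, contradicting
essentiality.  This is the tree form of "a twisted round handle would give torus-side
monodromy `-1` on the vanishing cycle, detected on `H₁`".

## References

* R. İ. Baykur, S. Kamada, *Classification of broken Lefschetz fibrations with small fiber
  genera*, J. Math. Soc. Japan 67 (2015), §2. [BaykurKamada2015]
* K. Hayano, *On genus-1 simplified broken Lefschetz fibrations*, Algebr. Geom. Topol. 11
  (2011), §2.3. [Hayano2011]
* A. Hatcher, *Algebraic Topology* (2002), Thm. 2.10, Thm. 2A.1, Cor. 2.11. [HatcherAT2002]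
-/

set_option linter.dupNamespace false

noncomputable section

open scoped Manifold ContDiff Topology RealInnerProductSpace
open Set Function Filter Metric Literature.Topology.FourManifolds
  Literature.AlgebraicTopology.SingularHomology

namespace Summit.SmoothPoincare4.SmoothPoincare4.Cruxes.RungOne.Sketch

/-- Local notation: `𝔼 n` is the model Euclidean space `EuclideanSpace ℝ (Fin n)`. -/
local notation "𝔼 " n:arg => EuclideanSpace ℝ (Fin n)

/-- Local notation: `𝕊²`, the unit sphere of `ℝ³`. -/
local notation "𝕊²" => (Metric.sphere (0 : EuclideanSpace ℝ (Fin 3)) (1 : ℝ))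

attribute [local instance] Literature.Topology.FourManifolds.fact_finrank_euclideanSpace_succ

/-- **`H₁` of the torus side is torsion-free**: for a genus-one Lefschetz-free SBLF with
equatorial round image and torus-side pole `v`, a class `x ∈ H₁(f⁻¹{⟪y, v⟫ > 0}; ℤ)` with
`2x = 0` vanishes (the side is `F × ℝ²` with `H₁(F) ≅ ℤ²`). [cite: BaykurKamada2015, §2] -/
theorem eq_zero_of_two_smul_torusSide {X : Type} [TopologicalSpace X] [T2Space X]
    [SecondCountableTopology X] [CompactSpace X] [ChartedSpace (𝔼 4) X] [IsManifold (𝓡 4) ∞ X]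
    {o : SmoothOrientation (𝓡 4) X} {f : X → 𝕊²} (hf : IsSimplifiedBrokenLefschetzFibration o f ∅ 0)
    (hround : f '' ({p : X | ¬ Surjective (mfderiv (𝓡 4) (𝓡 2) f p)} \ (↑(∅ : Finset X) : Set X)) =
      sphereEquator 1)
    {v : 𝕊²} (hv0 : (v : 𝔼 3) 0 = 0) (hv1 : (v : 𝔼 3) 1 = 0)
    (hhi : ∀ y : 𝕊², ⟪(y : 𝔼 3), ((-v : 𝕊²) : 𝔼 3)⟫ < 0 →
      (∀ q, f q = y → Surjective (mfderiv (𝓡 4) (𝓡 2) f q)) ∧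
      Nonempty ((Fin (2 * (0 + 1)) → ℤ) ≃ₗ[ℤ] singularHomology ℤ ℤ ↥(f ⁻¹' {y}) 1))
    (x : singularHomology ℤ ℤ ↥(f ⁻¹' {y : 𝕊² | 0 < ⟪(y : 𝔼 3), (v : 𝔼 3)⟫}) 1)
    (hx : (2 : ℤ) • x = 0) : x = 0 := by
  -- the torus side is `F × ℝ²`, with central fibre `f⁻¹(v)` of genus one
  have hnv0 : (((-v : 𝕊²) : 𝔼 3)) 0 = 0 := by simp [hv0]
  have hnv1 : (((-v : 𝕊²) : 𝔼 3)) 1 = 0 := by simp [hv1]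
  obtain ⟨F, _, _, _, _, _, _, _, ι, hemb, hrange, hemb0, hrange0, -⟩ :=
    hf.exists_isSmoothEmbedding_prod_range_eq_preimage_hemisphere hround (-v) hnv0 hnv1
  have hTeq : range ι = f ⁻¹' {y : 𝕊² | 0 < ⟪(y : 𝔼 3), (v : 𝔼 3)⟫} := by
    rw [hrange]
    ext q
    simp only [mem_preimage, mem_setOf_eq]
    rw [show (((-v : 𝕊²) : 𝔼 3)) = -(v : 𝔼 3) from rfl, inner_neg_right, neg_lt_zero]
  have hvv : f ⁻¹' {-(-v)} = f ⁻¹' {v} := by rw [neg_neg]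
  -- homeomorphisms `T ≃ F × ℝ²` and `F ≃ f⁻¹(v)`
  let eT : (F × 𝔼 2) ≃ₜ ↥(f ⁻¹' {y : 𝕊² | 0 < ⟪(y : 𝔼 3), (v : 𝔼 3)⟫}) :=
    hemb.isEmbedding.toHomeomorph.trans (Homeomorph.setCongr hTeq)
  let eF : F ≃ₜ ↥(f ⁻¹' {v}) :=
    hemb0.isEmbedding.toHomeomorph.trans (Homeomorph.setCongr (hrange0.trans hvv))
  -- `H₁(T) ≅ H₁(F × ℝ²) ≅ H₁(F) ≅ H₁(f⁻¹(v)) ≅ ℤ²`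
  obtain ⟨hE⟩ := nonempty_homotopyEquiv_prod_of_contractibleSpace (A := F) (C := 𝔼 2)
  obtain ⟨-, ⟨L⟩⟩ := hhi v (by
    rw [show (((-v : 𝕊²) : 𝔼 3)) = -(v : 𝔼 3) from rfl, inner_neg_right, neg_lt_zero,
      real_inner_self_eq_norm_sq, norm_eq_of_mem_sphere]
    norm_num)
  let i₁ := singularHomology.mapIso ℤ ℤ eT.symm 1
  let i₂ := singularHomology.isoOfHomotopyEquiv ℤ ℤ hE 1
  let i₃ := singularHomology.mapIso ℤ ℤ eF 1
  let φ : singularHomology ℤ ℤ ↥(f ⁻¹' {y : 𝕊² | 0 < ⟪(y : 𝔼 3), (v : 𝔼 3)⟫}) 1 →+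
      (Fin (2 * (0 + 1)) → ℤ) :=
    L.symm.toAddMonoidHom.comp (((i₁ ≪≫ i₂) ≪≫ i₃).hom.hom.toAddMonoidHom)
  have hφinj : Injective φ := by
    refine L.symm.injective.comp ?_
    exact (CategoryTheory.ConcreteCategory.bijective_of_isIso ((i₁ ≪≫ i₂) ≪≫ i₃).hom).1
  have h2 : (2 : ℤ) • φ x = 0 := by rw [← map_zsmul, hx, map_zero]
  have hφx : φ x = 0 := by
    rcases smul_eq_zero.1 h2 with h | h
    · norm_num at h
    · exact h
  exact hφinj (hφx.trans (map_zero φ).symm)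

/-- **Untwistedness of the round handle from the essentiality of the vanishing cycle.**
Assume that for every genus-one Lefschetz-free SBLF with equatorial round image (torus-side
pole `v`, round circle `e`, tube `ν₀`, height family `g` with page Hessians `H_t`) and every
`H_0`-orthogonal `H_0`-spacelike pair `b₁, b₂` the circles
`θ ↦ ν₀ (circlePt 0, r (cos 2πθ b₁ + sin 2πθ b₂))`, `r > 0` small, have non-zero Hurewicz class
in `H₁(f⁻¹{⟪y, v⟫ > 0}; ℤ)`.  Then along every tube about the round circle there is a
continuous `1`-periodic field `w` of `H_t`-timelike vectors (the conclusion of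
`helper_foldNF_timelike`). [cite: BaykurKamada2015, §2] [cite: Hayano2011, §2.3]
[cite: HatcherAT2002, Thm. 2.10 and Thm. 2A.1] -/
theorem helper_timelike_of_essential : (∀ (X : Type) [TopologicalSpace X] [T2Space X] [SecondCountableTopology X] [CompactSpace X] [ChartedSpace (𝔼 4) X] [IsManifold (𝓡 4) ∞ X] (o : SmoothOrientation (𝓡 4) X) (f : X → 𝕊²), IsSimplifiedBrokenLefschetzFibration o f ∅ 0 → f '' ({p : X | ¬ Surjective (mfderiv (𝓡 4) (𝓡 2) f p)} \ (↑(∅ : Finset X) : Set X)) = sphereEquator 1 → ∀ (v : 𝕊²), (v : 𝔼 3) 0 = 0 → (v : 𝔼 3) 1 = 0 → (∀ y : 𝕊², ⟪(y : 𝔼 3), (v : 𝔼 3)⟫ < 0 → (∀ q, f q = y → Surjective (mfderiv (𝓡 4) (𝓡 2) f q)) ∧ Nonempty ((Fin (2 * 0) → ℤ) ≃ₗ[ℤ] singularHomology ℤ ℤ ↥(f ⁻¹' {y}) 1)) → (∀ y : 𝕊², ⟪(y : 𝔼 3), ((-v : 𝕊²) : 𝔼 3)⟫ < 0 → (∀ q,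 f q = y → Surjective (mfderiv (𝓡 4) (𝓡 2) f q)) ∧ Nonempty ((Fin (2 * (0 + 1)) → ℤ) ≃ₗ[ℤ] singularHomology ℤ ℤ ↥(f ⁻¹' {y}) 1)) → ∀ (e : Metric.sphere (0 : 𝔼 2) 1 → X) (ν₀ : CircleNbhd (𝓡 4) e), Set.range e = {p : X | ¬ Surjective (mfderiv (𝓡 4) (𝓡 2) f p)} \ (↑(∅ : Finset X) : Set X) → (∀ u, f (e u) = sphereInclusion 1 2 one_le_two u) → ∀ (b₁ b₂ : 𝔼 3), 0 < fderiv ℝ (fderiv ℝ (fun q : ℝ × 𝔼 3 => SphereHeight.height (v : 𝔼 3) (f (ν₀.toFun (circlePt q.1, q.2))))) ((0 : ℝ), (0 : 𝔼 3)) ((0 : ℝ), b₁) ((0 : ℝ), b₁) → 0 < fderiv ℝ (fderiv ℝ (fun q : ℝ × 𝔼 3 => SphereHeight.height (v : 𝔼 3) (f (ν₀.toFun (circlePt q.1, q.2))))) ((0 : ℝ), (0 : 𝔼 3)) ((0 : ℝ), b₂) ((0 : ℝ), b₂) → fderiv ℝ (fderiv ℝ (fun q : ℝ × 𝔼 3 =>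 SphereHeight.height (v : 𝔼 3) (f (ν₀.toFun (circlePt q.1, q.2))))) ((0 : ℝ), (0 : 𝔼 3)) ((0 : ℝ), b₁) ((0 : ℝ), b₂) = 0 → ∃ r₀ : ℝ, 0 < r₀ ∧ ∀ r : ℝ, 0 < r → r ≤ r₀ → ∀ (x₀ : ↥(f ⁻¹' {y : 𝕊² | 0 < ⟪(y : 𝔼 3), (v : 𝔼 3)⟫})) (γ : Path x₀ x₀), (∀ τ : unitInterval, ((γ τ : ↥(f ⁻¹' {y : 𝕊² | 0 < ⟪(y : 𝔼 3), (v : 𝔼 3)⟫})) : X) = ν₀.toFun (circlePt 0, r • (Real.cos (2 * Real.pi * (τ : ℝ)) • b₁ + Real.sin (2 * Real.pi * (τ : ℝ)) • b₂))) → loopClass ℤ ℤ (1 : ℤ) γ ≠ 0) → ∀ (X : Type) [TopologicalSpace X] [T2Space X] [SecondCountableTopology X] [CompactSpace X] [ChartedSpace (𝔼 4) X] [IsManifold (𝓡 4) ∞ X] (o : SmoothOrientation (𝓡 4) X) (f : X → 𝕊²), IsSimplifiedBrokenLefschetzFibration o f ∅ 0 → f '' ({p : X | ¬ Surjective (mfderiv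 (𝓡 4) (𝓡 2) f p)} \ (↑(∅ : Finset X) : Set X)) = sphereEquator 1 → ∀ (v : 𝕊²), (v : 𝔼 3) 0 = 0 → (v : 𝔼 3) 1 = 0 → (∀ y : 𝕊², ⟪(y : 𝔼 3), (v : 𝔼 3)⟫ < 0 → (∀ q, f q = y → Surjective (mfderiv (𝓡 4) (𝓡 2) f q)) ∧ Nonempty ((Fin (2 * 0) → ℤ) ≃ₗ[ℤ] singularHomology ℤ ℤ ↥(f ⁻¹' {y}) 1)) → (∀ y : 𝕊², ⟪(y : 𝔼 3), ((-v : 𝕊²) : 𝔼 3)⟫ < 0 → (∀ q, f q = y → Surjective (mfderiv (𝓡 4) (𝓡 2) f q)) ∧ Nonempty ((Fin (2 * (0 + 1)) → ℤ) ≃ₗ[ℤ] singularHomology ℤ ℤ ↥(f ⁻¹' {y}) 1)) → ∀ (e : Metric.sphere (0 : 𝔼 2) 1 → X) (ν₀ : CircleNbhd (𝓡 4) e), Set.range e = {p : X | ¬ Surjective (mfderiv (𝓡 4) (𝓡 2) f p)} \ (↑(∅ : Finset X) : Set X) → (∀ u, f (e u) = sphereInclusion 1 2 one_le_two u) → ∃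 w : ℝ → 𝔼 3, Continuous w ∧ (∀ t : ℝ, w (t + 1) = w t) ∧ ∀ t : ℝ, fderiv ℝ (fderiv ℝ (fun q : ℝ × 𝔼 3 => SphereHeight.height (v : 𝔼 3) (f (ν₀.toFun (circlePt q.1, q.2))))) (t, 0) ((0 : ℝ), w t) ((0 : ℝ), w t) < 0 := by
  intro hESS X _ _ _ _ _ _ o f hf hround v hv0 hv1 hlo hhi e ν₀ hrange hfe
  rcases helper_timelike_dichotomy X o f hf hround v hv0 hv1 hlo hhi e ν₀ hrange hfe with
    hw | ⟨n, hn, hnT, hnneg⟩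
  · exact hw
  exfalso
  -- the twisted alternative: the vanishing cycle returns reversed through the torus side
  obtain ⟨b₁, b₂, r₀, hb₁, hb₂, hb₁₂, hr₀, hfam⟩ :=
    helper_timelike_reversedLoop X o f hf hround v hv0 hv1 hlo hhi e ν₀ hrange hfe n hn hnT hnneg
  obtain ⟨r₁, hr₁, hess⟩ := hESS X o f hf hround v hv0 hv1 hlo hhi e ν₀ hrange hfe b₁ b₂ hb₁ hb₂ hb₁₂
  set r : ℝ := min r₀ r₁ with hrdef
  have hr : 0 < r := lt_min hr₀ hr₁
  obtain ⟨L₁, L₂, hL₁, hL₂, hp₁, hp₂, h12, hrev, hpos₁, hpos₂, hform⟩ :=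
    hfam r hr (min_le_left _ _)
  -- corestriction to the torus side `T`
  set T : Set X := f ⁻¹' {y : 𝕊² | 0 < ⟪(y : 𝔼 3), (v : 𝔼 3)⟫} with hT
  have hmem : ∀ q : X, 0 < SphereHeight.height (v : 𝔼 3) (f q) → q ∈ T := fun q hq => by
    change 0 < ⟪((f q : 𝕊²) : 𝔼 3), (v : 𝔼 3)⟫
    rwa [real_inner_comm, ← SphereHeight.height_apply]
  set M₁ : ℝ × ℝ → ↥T := fun p => ⟨L₁ p, hmem _ (hpos₁ p.1 p.2)⟩ with hM₁
  set M₂ : ℝ × ℝ → ↥T := fun p => ⟨L₂ p, hmem _ (hpos₂ p.1 p.2)⟩ with hM₂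
  have hM₁c : Continuous M₁ := hL₁.subtype_mk _
  have hM₂c : Continuous M₂ := hL₂.subtype_mk _
  -- the based loop `γ = M₁ (0, ·)|[0,1]`
  set x₀ : ↥T := M₁ (0, 0) with hx₀
  have hend : M₁ (0, 1) = x₀ := by
    apply Subtype.ext
    change L₁ (0, 1) = L₁ (0, 0)
    rw [← zero_add (1 : ℝ), hp₁ 0 0]
  let γ : Path x₀ x₀ :=
    { toFun := fun τ => M₁ (0, (τ : ℝ))
      continuous_toFun := hM₁c.comp (continuous_const.prodMk continuous_subtype_val)
      source' := by simp [hx₀]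
      target' := by simpa using hend }
  -- `2 h(γ) = 0` by the reversal lemma ...
  have h2 : (2 : ℤ) • loopClass ℤ ℤ (1 : ℤ) γ = 0 :=
    helper_timelike_loopReversal (↥T) M₁ M₂ hM₁c hM₂c
      (fun s θ => Subtype.ext (hp₁ s θ)) (fun s θ => Subtype.ext (hp₂ s θ))
      (fun θ => Subtype.ext (h12 θ)) (fun θ => Subtype.ext (hrev θ)) γ (fun τ => rfl)
  -- ... hence `h(γ) = 0` (torsion-freeness), contradicting essentiality
  have h0 : loopClass ℤ ℤ (1 : ℤ) γ = 0 := eq_zero_of_two_smul_torusSide hf hround hv0 hv1 hhi _ h2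
  exact hess r hr (min_le_right _ _) x₀ γ (fun τ => hform τ) h0

end Summit.SmoothPoincare4.SmoothPoincare4.Cruxes.RungOne.Sketch

end
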